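import Literature.AlgebraicGeometry.Frobenioids.NumberFieldLocalizationsAut
import Literature.AlgebraicGeometry.Frobenioids.NumberFieldLocalizationCategories
import Literature.AlgebraicGeometry.Frobenioids.BCatOrbits
import Mathlib.GroupTheory.SpecificGroups.Alternating
import HarnessLib

/-!
# Frobenioids II, Proposition 1.5 (iv): the printed SECOND bijection fails for `(G, D) = (S₃, A₃)`, `P = P₀`

Mochizuki, *The geometry of Frobenioids II: poly-Frobenioids*, Kyushu J. Math. **62** (2008)
401–460, §1, Proposition 1.5 (iv), author's text p. 14 (kurims `paper:url-4322d76898e0`)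
[cite: MochizukiFrdII2008, Prop. 1.5 (iv) p.14]: "(iv) If `E ∈ Ob(E)` projects to an object
`P ∈ Ob(P)`, then we have natural bijections `Aut(P_P → P) ⥲ Aut(E_E → P)`; `Aut(E_E → E) ⥲ Aut(E_E → P)`
[induced by composition with the natural functors `E → P`, `E_E → P_P`]. In particular, `P` is slim if and
only if `E` is; `P` is Frobenius-slim if and only if `E` is."  The printed proof (p. 14 l.41–45) rests the
SECOND bijection on the `Aut`-bijection "`Aut_{E₀}(E₀) ⥲ Aut_{P₀}(P₀)`" of Example 1.4 (ii), which the
tree REFUTES at `(G, D) = (S₃, A₃)` (`NFLocCat.not_autBijective_perm_fin_three`, seat abc-iut-L1-d9,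
file `NumberFieldLocalizationCategoriesAutWitness.lean`).

The statement typer abc-iut-L1-t8 typed the second map as `NFLoc.autWhiskerToP`, PROVED its injectivity
(`NFLoc.autWhiskerToP_injective`) and recorded — in a module docstring only, deliberately NOT as a named
fact (RULING P1) — ERRATUM CANDIDATE E2: its surjectivity "appears to fail already for the `E₀ → P₀` of
Example 1.4 with `(Gal(F̃/F), D_v) ≅ (S₃, A₃)` (`F̃ = ℚ(∛2, ζ₃)/ℚ`, `v = 7`) and `P = P₀`: the constant
family 'translate by a generator of `A₃`' is a natural automorphism of `E_E → P` that does not lift to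
`E`".  This PROOF-ONLY file KERNEL-CHECKS exactly that sentence (sub-DAG W1 of plan/L1/DISCHARGE-L1.md
§0, row P15-L04d of `SUBDAG-FrdII-Prop15.md`, seat abc-iut-w5-d174):

* `NFLocCat.not_autWhiskerToP_surjective_perm_fin_three` — for `G = S₃` (discrete topology, hence
  profinite), `D = A₃`, `P := P₀ = B(A₃)⁰` with `P → P₀` the IDENTITY functor, and the object
  `X = (A, (A, Q, id), id)` of `E = P₀ ×_{P₀} E₀` where `Q = {0,1,2}` with its `S₃`-action and
  `A = Q|_{A₃}`: the natural automorphism "act by the `3`-cycle" of `E_X → P₀` (natural because the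
  `3`-cycle is central in `A₃`) is not the whisker of any automorphism of `E_X → E` — its component at
  `id_X` would be an endomorphism of `(A, Q, id)` in `E₀` with `P`-component the rotation, whose
  `S₃`-equivariant `Q`-component fixes `0` (the unique fixed point of `(1 2)`), contradicting the
  compatibility with `ι = id`.
* `NFLocCat.exists_profinite_not_autWhiskerToP_surjective` — packaged: the printed second bijection of
  Prop. 1.5 (iv) fails for SOME profinite `G`, closed `D`, and `P → P₀` the identity, i.e. in a case where
  every Example 1.4 (ii) property that the tree DISCHARGES (faithful, arrow-wise essentially surjective,
  the reconstruction bijection of (i)) holds.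

What is NOT claimed (no side taken): nothing here says how the printed sentence should be read or
repaired — the consumed direction "`P` slim ⇒ `E` slim" / "`P` Frobenius-slim ⇒ `E` Frobenius-slim" is
PROVED in the tree (`NFLoc.isSlim_of_isSlim_fst`, `NFLoc.isFrobeniusSlim_of_isFrobeniusSlim_fst`) and is
all that [FrdII] Ex. 1.4 (iii) and §4–§5 use; whether `E₀` is slim at this instance (which would also
refute "`E` slim ⇒ `P` slim") is not decided here.  No definition, no named fact; refereed pre-IUT
material; nothing here bears on [IUTchIII] Cor. 3.12.
-/

namespace Literature.AlgebraicGeometry.Frobenioids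

namespace NFLocCat

open CategoryTheory
open scoped FintypeCatDiscrete

/-- **Erratum candidate E2 of FrdII Prop. 1.5 (iv), kernel-checked.**  For `G = S₃` (discrete) and
`D = A₃`, `P := P₀` with `P → P₀` the identity functor, there is an object `X` of `E = P₀ ×_{P₀} E₀` at
which the second map `Aut(E_E → E) → Aut(E_E → P)` of Prop. 1.5 (iv) (`NFLoc.autWhiskerToP X`) is NOT
surjective: the natural automorphism "act by the `3`-cycle" of `E_X → P₀` does not lift.
[cite: MochizukiFrdII2008, Prop. 1.5 (iv) p.14] -/
theorem not_autWhiskerToP_surjective_perm_fin_three :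
    ∃ X : NFLoc.Loc (𝟭 (@PCat (Equiv.Perm (Fin 3)) _ ⊥ (alternatingGroup (Fin 3))))
        (@toP₀ (Equiv.Perm (Fin 3)) _ ⊥ (alternatingGroup (Fin 3))),
      ¬ Function.Surjective (NFLoc.autWhiskerToP X) := by
  letI : TopologicalSpace (Equiv.Perm (Fin 3)) := ⊥
  haveI : DiscreteTopology (Equiv.Perm (Fin 3)) := ⟨rfl⟩
  haveI : IsTopologicalGroup (Equiv.Perm (Fin 3)) :=
    { continuous_mul := continuous_of_discreteTopology
      continuous_inv := continuous_of_discreteTopology }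
  -- notation
  let G := Equiv.Perm (Fin 3)
  let D : Subgroup G := alternatingGroup (Fin 3)
  let c : G := finRotate 3
  have hc : c ∈ D := by
    change Equiv.Perm.sign (finRotate (2 + 1)) = 1
    rw [sign_finRotate]
    norm_num
  have hcomm' : ∀ σ : Equiv.Perm (Fin 3), Equiv.Perm.sign σ = 1 → σ * finRotate 3 = finRotate 3 * σ := by
    decide
  -- the `3`-cycle as a (central) element of `D = A₃`
  let z : D := ⟨c, hc⟩
  have hz : ∀ d : D, z * d = d * z := fun d =>
    Subtype.ext (hcomm' d.1 (Equiv.Perm.mem_alternatingGroup.mp d.2)).symm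
  -- the `S₃`-set `{0,1,2}`
  let QA : Action FintypeCat.{0} G := Action.FintypeCat.ofMulAction G (FintypeCat.of (Fin 3))
  have hQA : Action.IsContinuous QA := (BCat.isContinuous_iff QA).mpr fun _ => isOpen_discrete _
  let Q : BCat G := ⟨QA, hQA⟩
  let q0 : Q.obj.V := (0 : Fin 3)
  have smulQ : ∀ (σ : G) (x : Fin 3), σ • (show Q.obj.V from x) = (σ : Equiv.Perm (Fin 3)) x :=
    fun _ _ => rfl
  have hQ : IsConnectedObj Q := BCat.isConnectedObj_of_transitive Q q0 fun y =>
    ⟨Equiv.swap (0 : Fin 3) y, by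
      rw [smulQ]
      exact Equiv.swap_apply_left (0 : Fin 3) y⟩
  -- its restriction to `A₃`
  let P : BCat D := (res G D).obj Q
  let p0 : P.obj.V := (0 : Fin 3)
  have smulP : ∀ (d : D) (x : Fin 3), d • (show P.obj.V from x) = ((d : G) : Equiv.Perm (Fin 3)) x :=
    fun _ _ => rfl
  have hP : IsConnectedObj P := BCat.isConnectedObj_of_transitive P p0 fun y => by
    have hrot : ∀ w : Fin 3, ∃ k : ℕ, k < 3 ∧ ((finRotate 3) ^ k) 0 = w := by decide
    obtain ⟨k, -, hk⟩ := hrot y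
    exact ⟨⟨c ^ k, D.pow_mem hc k⟩, by rw [smulP]; exact hk⟩
  let A : PCat G D := ⟨P, hP⟩
  let T : ECat G D := ⟨⟨A, ⟨Q, hQ⟩, 𝟙 P⟩, show Mono (𝟙 P) from inferInstance⟩
  -- the object `X = (A, T, id)` of `E = P₀ ×_{P₀} E₀`
  let X : NFLoc.Loc (𝟭 (PCat G D)) (toP₀ G D) := ⟨A, T, Iso.refl A⟩
  refine ⟨X, fun hsurj => ?_⟩
  -- "act by `z`" on an arbitrary finite continuous `A₃`-set: a morphism of `B(A₃)` (as `z` is central)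
  let rot : ∀ Y : BCat D, Y ⟶ Y := fun Y => ObjectProperty.homMk
    { hom := FintypeCat.homMk fun x : Y.obj.V => z • x
      comm := fun d => by
        apply FintypeCat.hom_ext
        intro x
        simp only [FintypeCat.comp_apply, FintypeCat.homMk_apply]
        change z • (d • x) = d • (z • x)
        rw [smul_smul, smul_smul, hz d] }
  have rot_apply : ∀ (Y : BCat D) (x : Y.obj.V), (rot Y).hom.hom x = z • x := fun Y x => by
    change (FintypeCat.homMk fun x : Y.obj.V => z • x) x = z • x
    rw [FintypeCat.homMk_apply]
  -- it is natural in `Y`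
  have rot_natural : ∀ {Y Y' : BCat D} (f : Y ⟶ Y'), f ≫ rot Y' = rot Y ≫ f := fun {Y Y'} f => by
    apply BCat.hom_ext_apply
    intro x
    change (rot Y').hom.hom (f.hom.hom x) = f.hom.hom ((rot Y).hom.hom x)
    rw [rot_apply, rot_apply, BCat.hom_smul]
  -- and an isomorphism
  have rot_isIso : ∀ Y : BCat D, IsIso (rot Y) := fun Y =>
    BCat.isIso_of_bijective (rot Y) (by
      have : (fun x : Y.obj.V => (rot Y).hom.hom x) = fun x => z • x := funext (rot_apply Y)
      change Function.Bijective fun x : Y.obj.V => (rot Y).hom.hom x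
      rw [this]
      exact MulAction.bijective z)
  -- hence an automorphism of every object of `P₀ = B(A₃)⁰`, natural in the object
  let rotIso : ∀ B : PCat G D, B ≅ B := fun B =>
    (connectedObjects (BCat D)).isoMk (@asIso _ _ _ _ (rot B.obj) (rot_isIso B.obj))
  -- the natural automorphism "act by `z`" of `E_X → P₀`
  let cNat : Aut (Over.forget X ⋙ NFLoc.toP (𝟭 (PCat G D)) (toP₀ G D)) :=
    NatIso.ofComponents (fun U => rotIso ((Over.forget X ⋙ NFLoc.toP (𝟭 (PCat G D)) (toP₀ G D)).obj U))
      fun {U V} k => ObjectProperty.hom_ext _ (rot_natural k.left.fst.hom)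
  -- suppose it lifts to an automorphism `β` of `E_X → E`
  obtain ⟨β, hβ⟩ := hsurj cNat
  let U₀ : Over X := Over.mk (𝟙 X)
  let φ : X ⟶ X := β.hom.app U₀
  -- its component at `id_X` is an endomorphism `φ` of `X` with `P`-component the rotation
  have hφfst : φ.fst = ObjectProperty.homMk (rot P) := by
    have e := NFLoc.autWhiskerToP_app X β U₀
    rw [hβ] at e
    exact e.symm
  -- `φ = (φ_P, φ_T)` with `φ_P = (φ_T)_P` since the identification of `X` is the identity
  have hleft : φ.snd.hom.left = ObjectProperty.homMk (rot P) := by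
    have w := φ.w
    simp only [Functor.id_map] at w
    rw [← hφfst]
    exact w.symm
  -- on points: the `P`-component of `φ_T` is the `3`-cycle
  have ha0 : φ.snd.hom.left.hom.hom.hom p0 = c 0 := by
    rw [hleft]
    change (rot P).hom.hom p0 = c 0
    rw [rot_apply, smulP]
  -- the `Q`-component of `φ_T` is `S₃`-equivariant, hence fixes `0` (the only fixed point of `(1 2)`)
  have hb0 : φ.snd.hom.right.hom.hom.hom q0 = q0 := by
    have e := BCat.hom_smul φ.snd.hom.right.hom (Equiv.swap (1 : Fin 3) 2) q0
    have h0' : Equiv.swap (1 : Fin 3) 2 0 = 0 := by decide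
    have h0 : Equiv.swap (1 : Fin 3) 2 • q0 = q0 := by
      rw [smulQ]
      exact h0'
    rw [h0] at e
    have key : ∀ w : Fin 3, w = Equiv.swap (1 : Fin 3) 2 w → w = 0 := by decide
    exact key _ (e.trans (smulQ _ _))
  -- compatibility of `φ_T` with `ι = id`: both components agree on points, so `c 0 = 0`
  have hw := congrArg (fun k => k.hom.hom p0) φ.snd.hom.w
  have h : φ.snd.hom.left.hom.hom.hom p0 = p0 := hw.trans hb0
  rw [ha0] at h
  exact absurd (show c 0 = 0 from h) (by decide)

/-- **FrdII Prop. 1.5 (iv), second bijection: not valid as printed.**  There are a PROFINITE group `G`,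
a subgroup `D`, and — with `P := P₀`, `P → P₀` the identity functor — an object `X` of
`E = P ×_{P₀} E₀` for Example 1.4's `E₀ → P₀` at which `Aut(E_E → E) → Aut(E_E → P)` is not
surjective.  (At this `(G, D)` the functor `E₀ → P₀` is faithful, arrow-wise essentially surjective and
satisfies the reconstruction bijection of (i) — `toP₀Faithful_holds`, `toP₀ArrowwiseEssSurj_holds`,
`homReconstruction_toP₀` — so the failure is not an artefact of a missing Example 1.4 (ii) hypothesis
other than the refuted `Aut`-bijection.) [cite: MochizukiFrdII2008, Prop. 1.5 (iv) p.14] -/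
theorem exists_profinite_not_autWhiskerToP_surjective :
    ∃ (G : Type) (_ : Group G) (_ : TopologicalSpace G) (_ : IsTopologicalGroup G) (_ : CompactSpace G)
      (_ : TotallyDisconnectedSpace G) (D : Subgroup G)
      (X : NFLoc.Loc (𝟭 (PCat G D)) (toP₀ G D)), ¬ Function.Surjective (NFLoc.autWhiskerToP X) := by
  letI : TopologicalSpace (Equiv.Perm (Fin 3)) := ⊥
  haveI : DiscreteTopology (Equiv.Perm (Fin 3)) := ⟨rfl⟩
  haveI : IsTopologicalGroup (Equiv.Perm (Fin 3)) :=
    { continuous_mul := continuous_of_discreteTopology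
      continuous_inv := continuous_of_discreteTopology }
  obtain ⟨X, hX⟩ := not_autWhiskerToP_surjective_perm_fin_three
  exact ⟨Equiv.Perm (Fin 3), inferInstance, ⊥, inferInstance, inferInstance, inferInstance,
    alternatingGroup (Fin 3), X, hX⟩

end NFLocCat

end Literature.AlgebraicGeometry.Frobenioids
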